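import Summits.CriticalPhenomena.PercolationContinuityZ3.Theorems.PercNearOneGluingNoHeavyQuantTwoBigCellLLC2B1lo
import Summits.CriticalPhenomena.PercolationContinuityZ3.Theorems.PercNearOneGluingNoHeavyQuantTwoBigCellLLC2B2lo
import Summits.CriticalPhenomena.PercolationContinuityZ3.Theorems.PercNearOneGluingNoHeavyQuantTwoBigCellLLC2B0lo
import Summits.CriticalPhenomena.PercolationContinuityZ3.Theorems.PercNearOneGluingNoHeavyQuantTwoBigCellLLC2B1hi
import Summits.CriticalPhenomena.PercolationContinuityZ3.Theorems.PercNearOneGluingNoHeavyQuantTwoBigCellLLC2B2hi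
import Summits.CriticalPhenomena.PercolationContinuityZ3.Theorems.PercNearOneGluingNoHeavyQuantTwoBigCellLLC2B0hi
import Mathlib.Tactic.LinearCombination
import HarnessLib

/-!
# QUANT lane R8, Conjecture DIB\* — the two-big certificate, cell `LL/C2`

builds on p205010 (kernel theorem, internal audit signed; external expert review pending)

Support file (`--supports stmt-CriticalPhenomena-4575`), QUANT lane census-1 (gen 17); memo
`run/shared/lean/prim/quant/prim-quant-census-1/TWOBIG-G17.md`.  Theorems only, no definitions, no sorries, standard axioms.
Coordinates `y = 1 − x`, `uᵢ = αᵢφᵢ`, `vᵢ = αᵢ(1 − φᵢ)` (`αᵢ = bᵢ/j`, `φᵢ` = credit rate of big `i`); the three `tbcBlock_*` lemmas are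
LP-found Handelman certificates (products of the cell's defining inequalities, replayed by `linarith`) of a separable budget split
`c₁ + c₂ + c₀ = (1−y)α₁α₂ − P₁P₂`, `cₖ·Dₖ ≤ Bₖ·Nₖ`; `tbcCell_*` combines them into the reduced inequality of the cell
(items in product form).  [this work]; the gluing rows served [cite: KozmaNitzan2024, Conjecture 3 (p. 15)].
-/

namespace Summit.CriticalPhenomena.PercolationContinuityZ3.Theorems

namespace Quant

namespace IndepBlob

set_option maxHeartbeats 8000000 in
/-- **Two-big cell `LL/C2`** (two sub-cells `y ≶ 1/4`): the reduced inequality from the blocks. [this work] -/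
theorem tbcCell_LL_C2 (y u₁ v₁ u₂ v₂ t₁ t₂ t₀ : ℝ) (hy0 : 0 < y) (hhy : y ≤ 1 / 2) (hu1 : 0 ≤ u₁) (hv1 : 0 ≤ v₁) (hu2 : 0 ≤ u₂) (hv2 : 0 ≤ v₂)
    (ha1 : u₁ + v₁ ≤ 1) (hb1 : 1 / 2 ≤ u₁ + v₁) (ha2 : u₂ + v₂ ≤ 1) (hb2 : 1 / 2 ≤ u₂ + v₂) (ht1 : 0 ≤ (1 - y) * v₁ - u₁ * y)
    (ht2 : 0 ≤ (1 - y) * v₂ - u₂ * y) (hc1 : 0 ≤ 1 - (2 - u₁ - u₂)) (hr1 : 0 ≤ (2 - u₁ - u₂) - (2 - y) * (1 - u₁ - v₁))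
    (hr2 : 0 ≤ (2 - u₁ - u₂) - (2 - y) * (1 - u₂ - v₂)) (hct : 0 < (2 - u₁ - u₂))
    (hT1 : (1 + v₁ - u₂) ^ 2 ≤ t₁ * (y * (2 - u₁ - u₂) + (1 + v₁ - u₂) ^ 2)) (hT2 : (1 + v₂ - u₁) ^ 2 ≤ t₂ * (y * (2 - u₁ - u₂) + (1 + v₂ - u₁) ^ 2))
    (hT0 : 0 ≤ t₀) :
    (1 - y) * ((u₁ + v₁) * (u₂ + v₂))
      ≤ ((u₁ + v₁) * (1 - y) ^ 2 + y * u₁) * ((u₂ + v₂) * (1 - y) ^ 2 + y * u₂) + ((u₁ + v₁) * (1 - y) ^ 2 + y * u₁) * (y * ((u₂ + v₂) * (2 - y) - u₂)) * t₁ + (y * ((u₁ + v₁) * (2 - y)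
            - u₁)) * ((u₂ + v₂) * (1 - y) ^ 2 + y * u₂) * t₂ + (y * ((u₁ + v₁) * (2 - y) - u₁)) * (y * ((u₂ + v₂) * (2 - y) - u₂)) * t₀ := by
  by_cases hsub0 : y ≤ 1 / 4
  · have hsub : (0:ℝ) ≤ 1 / 4 - y := by linarith
    have b1 := tbcBlock_LL_C2_lo_1 y u₁ v₁ u₂ v₂ hy0.le (by linarith) hu1 hv1 hu2 hv2 (by linarith) (by linarith) (by linarith) (by linarith) ht1 ht2 hc1 hr1 hr2 hsub
    have b2 := tbcBlock_LL_C2_lo_2 y u₁ v₁ u₂ v₂ hy0.le (by linarith) hu1 hv1 hu2 hv2 (by linarith) (by linarith) (by linarith) (by linarith) ht1 ht2 hc1 hr1 hr2 hsub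
    have b0 := tbcBlock_LL_C2_lo_0 y u₁ v₁ u₂ v₂ hy0.le (by linarith) hu1 hv1 hu2 hv2 (by linarith) (by linarith) (by linarith) (by linarith) ht1 ht2 hc1 hr1 hr2 hsub
    set C1e : ℝ := -33 / 512 + 61 / 256 * y + 151 / 1024 * u₁ + 181 / 1024 * v₁ + 203 / 1024 * u₂ + 315 / 1024 * v₂ + 867 / 1024 * y ^ 2 - 495 / 512 * y * u₁ - 1085 / 1024 * y * v₁ -
          415 / 512 * y * u₂ - 353 / 256 * y * v₂ + 167 / 1024 * u₁ ^ 2 + 155 / 1024 * u₁ * v₁ + 259 / 1024 * u₁ * u₂ + 453 / 512 * u₁ * v₂ + 1 / 1024 * v₁ ^ 2 + 475 / 1024 * v₁ * u₂ +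
          527 / 512 * v₁ * v₂ - 101 / 512 * u₂ ^ 2 - 61 / 512 * u₂ * v₂ + 3 / 512 * v₂ ^ 2 with hC1e
    set C2e : ℝ := -81 / 1024 + 275 / 1024 * y + 47 / 256 * u₁ + 327 / 1024 * v₁ + 165 / 1024 * u₂ + 229 / 1024 * v₂ + 183 / 256 * y ^ 2 - 51 / 64 * y * u₁ - 619 / 512 * y * v₁ - 477 /
          512 * y * u₂ - 1003 / 1024 * y * v₂ - 47 / 256 * u₁ ^ 2 - 169 / 1024 * u₁ * v₁ + 17 / 64 * u₁ * u₂ + 423 / 1024 * u₁ * v₂ + 7 / 1024 * v₁ ^ 2 + 883 / 1024 * v₁ * u₂ + 551 /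
          512 * v₁ * v₂ + 39 / 256 * u₂ ^ 2 + 41 / 512 * u₂ * v₂ - 1 / 1024 * v₂ ^ 2 with hC2e
    set C0e : ℝ := 493 / 1024 * u₁ * u₂ + 719 / 1024 * u₁ * v₂ + 345 / 512 * v₁ * u₂ + 229 / 256 * v₁ * v₂ - 3 * y * u₁ * u₂ - 4 * y * u₁ * v₂ + 2 * y ^ 2 * u₁ * u₂ + 3 * y ^ 2 * u₁ *
          v₂ - y ^ 3 * u₁ * u₂ - y ^ 3 * u₁ * v₂ - 4 * y * v₁ * u₂ - 6 * y * v₁ * v₂ + 3 * y ^ 2 * v₁ * u₂ + 4 * y ^ 2 * v₁ * v₂ - y ^ 3 * v₁ * u₂ - y ^ 3 * v₁ * v₂ + 147 / 1024 - 519 /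
          1024 * y - 339 / 1024 * u₁ - 127 / 256 * v₁ - 23 / 64 * u₂ - 17 / 32 * v₂ - 1599 / 1024 * y ^ 2 + 903 / 512 * y * u₁ + 2323 / 1024 * y * v₁ + 223 / 128 * y * u₂ + 2415 / 1024
          * y * v₂ + 21 / 1024 * u₁ ^ 2 + 7 / 512 * u₁ * v₁ - 1 / 128 * v₁ ^ 2 + 23 / 512 * u₂ ^ 2 + 5 / 128 * u₂ * v₂ - 5 / 1024 * v₂ ^ 2 with hC0e
    have hD1 : (0:ℝ) < (y * (2 - u₁ - u₂) + (1 + v₁ - u₂) ^ 2) := by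
      have h1 := mul_pos hy0 hct
      have h2 := sq_nonneg (1 + v₁ - u₂)
      linarith
    have hD2 : (0:ℝ) < (y * (2 - u₁ - u₂) + (1 + v₂ - u₁) ^ 2) := by
      have h1 := mul_pos hy0 hct
      have h2 := sq_nonneg (1 + v₂ - u₁)
      linarith
    have hP1 : (0:ℝ) ≤ ((u₁ + v₁) * (1 - y) ^ 2 + y * u₁) := by
      have h1 := mul_nonneg (show (0:ℝ) ≤ u₁ + v₁ by linarith) (sq_nonneg (1 - y))
      have h2 := mul_nonneg hy0.le hu1
      linarith
    have hQt1 : (0:ℝ) ≤ ((u₁ + v₁) * (2 - y) - u₁) := by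
      have h1 := mul_nonneg (show (0:ℝ) ≤ 1 - y by linarith) (show (0:ℝ) ≤ u₁ + v₁ by linarith)
      linarith
    have hQ1 : (0:ℝ) ≤ (y * ((u₁ + v₁) * (2 - y) - u₁)) := mul_nonneg hy0.le hQt1
    have hP2 : (0:ℝ) ≤ ((u₂ + v₂) * (1 - y) ^ 2 + y * u₂) := by
      have h1 := mul_nonneg (show (0:ℝ) ≤ u₂ + v₂ by linarith) (sq_nonneg (1 - y))
      have h2 := mul_nonneg hy0.le hu2
      linarith
    have hQt2 : (0:ℝ) ≤ ((u₂ + v₂) * (2 - y) - u₂) := by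
      have h1 := mul_nonneg (show (0:ℝ) ≤ 1 - y by linarith) (show (0:ℝ) ≤ u₂ + v₂ by linarith)
      linarith
    have hQ2 : (0:ℝ) ≤ (y * ((u₂ + v₂) * (2 - y) - u₂)) := mul_nonneg hy0.le hQt2
    have hBF1 : (0:ℝ) ≤ (((u₁ + v₁) * (1 - y) ^ 2 + y * u₁) * ((u₂ + v₂) * (2 - y) - u₂)) := mul_nonneg hP1 hQt2
    have k1 : C1e ≤ (((u₁ + v₁) * (1 - y) ^ 2 + y * u₁) * ((u₂ + v₂) * (2 - y) - u₂)) * t₁ := tbc_block_le _ _ _ _ _ hBF1 hD1 hT1 b1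
    have hBF2 : (0:ℝ) ≤ (((u₁ + v₁) * (2 - y) - u₁) * ((u₂ + v₂) * (1 - y) ^ 2 + y * u₂)) := mul_nonneg hQt1 hP2
    have k2 : C2e ≤ (((u₁ + v₁) * (2 - y) - u₁) * ((u₂ + v₂) * (1 - y) ^ 2 + y * u₂)) * t₂ := tbc_block_le _ _ _ _ _ hBF2 hD2 hT2 b2
    have hB0 : (0:ℝ) ≤ (y * (((u₁ + v₁) * (2 - y) - u₁) * ((u₂ + v₂) * (2 - y) - u₂))) := mul_nonneg hy0.le (mul_nonneg hQt1 hQt2)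
    have k0 : C0e ≤ (y * (((u₁ + v₁) * (2 - y) - u₁) * ((u₂ + v₂) * (2 - y) - u₂))) * t₀ := b0.trans (mul_nonneg hB0 hT0)
    have e : y * (C1e + C2e + C0e) = (1 - y) * ((u₁ + v₁) * (u₂ + v₂)) - ((u₁ + v₁) * (1 - y) ^ 2 + y * u₁) * ((u₂ + v₂) * (1 - y) ^ 2 + y * u₂) := by
      rw [hC1e, hC2e, hC0e]; ring
    have hsum := mul_le_mul_of_nonneg_left (add_le_add (add_le_add k1 k2) k0) hy0.le
    calc (1 - y) * ((u₁ + v₁) * (u₂ + v₂)) = ((u₁ + v₁) * (1 - y) ^ 2 + y * u₁) * ((u₂ + v₂) * (1 - y) ^ 2 + y * u₂) + y * (C1e + C2e + C0e) := by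
          rw [e]; ring
      _ ≤ ((u₁ + v₁) * (1 - y) ^ 2 + y * u₁) * ((u₂ + v₂) * (1 - y) ^ 2 + y * u₂) + y * ((((u₁ + v₁) * (1 - y) ^ 2 + y * u₁) * ((u₂ + v₂) * (2 - y) - u₂)) * t₁ + (((u₁ + v₁) * (2 - y) -
            u₁) * ((u₂ + v₂) * (1 - y) ^ 2 + y * u₂)) * t₂ + (y * (((u₁ + v₁) * (2 - y) - u₁) * ((u₂ + v₂) * (2 - y) - u₂))) * t₀) := add_le_add le_rfl hsum
      _ = _ := by ring
  · have hsub : (0:ℝ) ≤ y - 1 / 4 := by linarith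
    have b1 := tbcBlock_LL_C2_hi_1 y u₁ v₁ u₂ v₂ hy0.le (by linarith) hu1 hv1 hu2 hv2 (by linarith) (by linarith) (by linarith) (by linarith) ht1 ht2 hc1 hr1 hr2 hsub
    have b2 := tbcBlock_LL_C2_hi_2 y u₁ v₁ u₂ v₂ hy0.le (by linarith) hu1 hv1 hu2 hv2 (by linarith) (by linarith) (by linarith) (by linarith) ht1 ht2 hc1 hr1 hr2 hsub
    have b0 := tbcBlock_LL_C2_hi_0 y u₁ v₁ u₂ v₂ hy0.le (by linarith) hu1 hv1 hu2 hv2 (by linarith) (by linarith) (by linarith) (by linarith) ht1 ht2 hc1 hr1 hr2 hsub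
    set C1e : ℝ := 13 / 64 * y + 3 / 64 * u₁ + 99 / 256 * v₁ + 89 / 256 * v₂ + 125 / 256 * y ^ 2 - 239 / 256 * y * u₁ - 133 / 128 * y * v₁ - 59 / 128 * y * u₂ - 225 / 256 * y * v₂ + 19
          / 128 * u₁ ^ 2 + 1 / 8 * u₁ * v₁ + 51 / 128 * u₁ * u₂ + 201 / 256 * u₁ * v₂ - 1 / 128 * v₁ ^ 2 + 7 / 32 * v₁ * u₂ + 93 / 128 * v₁ * v₂ - 21 / 256 * u₂ ^ 2 - 67 / 256 * u₂ * v₂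
          - 1 / 32 * v₂ ^ 2 with hC1e
    set C2e : ℝ := 19 / 128 * y + 25 / 256 * u₁ + 45 / 256 * v₁ + 5 / 32 * u₂ + 27 / 256 * y ^ 2 - 43 / 128 * y * u₁ - 101 / 128 * y * v₁ - 181 / 256 * y * u₂ - 181 / 256 * y * v₂ - 41
          / 256 * u₁ ^ 2 - 31 / 256 * u₁ * v₁ + 21 / 128 * u₁ * u₂ + 65 / 128 * u₁ * v₂ + 231 / 256 * v₁ * u₂ + 187 / 256 * v₁ * v₂ + 7 / 128 * u₂ ^ 2 + 89 / 256 * u₂ * v₂ + 7 / 256 *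
          v₂ ^ 2 with hC2e
    set C0e : ℝ := 7 / 16 * u₁ * u₂ + 181 / 256 * u₁ * v₂ + 225 / 256 * v₁ * u₂ + 395 / 256 * v₁ * v₂ - 3 * y * u₁ * u₂ - 4 * y * u₁ * v₂ + 2 * y ^ 2 * u₁ * u₂ + 3 * y ^ 2 * u₁ * v₂ - y
          ^ 3 * u₁ * u₂ - y ^ 3 * u₁ * v₂ - 4 * y * v₁ * u₂ - 6 * y * v₁ * v₂ + 3 * y ^ 2 * v₁ * u₂ + 4 * y ^ 2 * v₁ * v₂ - y ^ 3 * v₁ * u₂ - y ^ 3 * v₁ * v₂ - 45 / 128 * y - 37 / 256 *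
          u₁ - 9 / 16 * v₁ - 89 / 256 * v₂ - 19 / 32 * y ^ 2 + 325 / 256 * y * u₁ + 117 / 64 * y * v₁ + 299 / 256 * y * u₂ + 203 / 128 * y * v₂ + 3 / 256 * u₁ ^ 2 - 1 / 256 * u₁ * v₁ +
          1 / 128 * v₁ ^ 2 + 7 / 256 * u₂ ^ 2 - 11 / 128 * u₂ * v₂ + 1 / 256 * v₂ ^ 2 - 5 / 32 * u₂ with hC0e
    have hD1 : (0:ℝ) < (y * (2 - u₁ - u₂) + (1 + v₁ - u₂) ^ 2) := by
      have h1 := mul_pos hy0 hct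
      have h2 := sq_nonneg (1 + v₁ - u₂)
      linarith
    have hD2 : (0:ℝ) < (y * (2 - u₁ - u₂) + (1 + v₂ - u₁) ^ 2) := by
      have h1 := mul_pos hy0 hct
      have h2 := sq_nonneg (1 + v₂ - u₁)
      linarith
    have hP1 : (0:ℝ) ≤ ((u₁ + v₁) * (1 - y) ^ 2 + y * u₁) := by
      have h1 := mul_nonneg (show (0:ℝ) ≤ u₁ + v₁ by linarith) (sq_nonneg (1 - y))
      have h2 := mul_nonneg hy0.le hu1
      linarith
    have hQt1 : (0:ℝ) ≤ ((u₁ + v₁) * (2 - y) - u₁) := by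
      have h1 := mul_nonneg (show (0:ℝ) ≤ 1 - y by linarith) (show (0:ℝ) ≤ u₁ + v₁ by linarith)
      linarith
    have hQ1 : (0:ℝ) ≤ (y * ((u₁ + v₁) * (2 - y) - u₁)) := mul_nonneg hy0.le hQt1
    have hP2 : (0:ℝ) ≤ ((u₂ + v₂) * (1 - y) ^ 2 + y * u₂) := by
      have h1 := mul_nonneg (show (0:ℝ) ≤ u₂ + v₂ by linarith) (sq_nonneg (1 - y))
      have h2 := mul_nonneg hy0.le hu2
      linarith
    have hQt2 : (0:ℝ) ≤ ((u₂ + v₂) * (2 - y) - u₂) := by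
      have h1 := mul_nonneg (show (0:ℝ) ≤ 1 - y by linarith) (show (0:ℝ) ≤ u₂ + v₂ by linarith)
      linarith
    have hQ2 : (0:ℝ) ≤ (y * ((u₂ + v₂) * (2 - y) - u₂)) := mul_nonneg hy0.le hQt2
    have hBF1 : (0:ℝ) ≤ (((u₁ + v₁) * (1 - y) ^ 2 + y * u₁) * ((u₂ + v₂) * (2 - y) - u₂)) := mul_nonneg hP1 hQt2
    have k1 : C1e ≤ (((u₁ + v₁) * (1 - y) ^ 2 + y * u₁) * ((u₂ + v₂) * (2 - y) - u₂)) * t₁ := tbc_block_le _ _ _ _ _ hBF1 hD1 hT1 b1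
    have hBF2 : (0:ℝ) ≤ (((u₁ + v₁) * (2 - y) - u₁) * ((u₂ + v₂) * (1 - y) ^ 2 + y * u₂)) := mul_nonneg hQt1 hP2
    have k2 : C2e ≤ (((u₁ + v₁) * (2 - y) - u₁) * ((u₂ + v₂) * (1 - y) ^ 2 + y * u₂)) * t₂ := tbc_block_le _ _ _ _ _ hBF2 hD2 hT2 b2
    have hB0 : (0:ℝ) ≤ (y * (((u₁ + v₁) * (2 - y) - u₁) * ((u₂ + v₂) * (2 - y) - u₂))) := mul_nonneg hy0.le (mul_nonneg hQt1 hQt2)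
    have k0 : C0e ≤ (y * (((u₁ + v₁) * (2 - y) - u₁) * ((u₂ + v₂) * (2 - y) - u₂))) * t₀ := b0.trans (mul_nonneg hB0 hT0)
    have e : y * (C1e + C2e + C0e) = (1 - y) * ((u₁ + v₁) * (u₂ + v₂)) - ((u₁ + v₁) * (1 - y) ^ 2 + y * u₁) * ((u₂ + v₂) * (1 - y) ^ 2 + y * u₂) := by
      rw [hC1e, hC2e, hC0e]; ring
    have hsum := mul_le_mul_of_nonneg_left (add_le_add (add_le_add k1 k2) k0) hy0.le
    calc (1 - y) * ((u₁ + v₁) * (u₂ + v₂)) = ((u₁ + v₁) * (1 - y) ^ 2 + y * u₁) * ((u₂ + v₂) * (1 - y) ^ 2 + y * u₂) + y * (C1e + C2e + C0e) := by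
          rw [e]; ring
      _ ≤ ((u₁ + v₁) * (1 - y) ^ 2 + y * u₁) * ((u₂ + v₂) * (1 - y) ^ 2 + y * u₂) + y * ((((u₁ + v₁) * (1 - y) ^ 2 + y * u₁) * ((u₂ + v₂) * (2 - y) - u₂)) * t₁ + (((u₁ + v₁) * (2 - y) -
            u₁) * ((u₂ + v₂) * (1 - y) ^ 2 + y * u₂)) * t₂ + (y * (((u₁ + v₁) * (2 - y) - u₁) * ((u₂ + v₂) * (2 - y) - u₂))) * t₀) := add_le_add le_rfl hsum
      _ = _ := by ring

end IndepBlob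

end Quant

end Summit.CriticalPhenomena.PercolationContinuityZ3.Theorems
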